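import Summits.Ventures.CertifiedArithmetic.LowPrec.Exact
import Summits.Ventures.CertifiedArithmetic.LowPrec.AccumulateDirected
import Summits.Ventures.CertifiedArithmetic.LowPrec.Sterbenz

/-!
# Exact inner products of grid alphabets: `W(n) = 0` below the Lemma-Z threshold (any order, any rounding)

HONEST FRAMING (venture CertifiedArithmetic / cell `pub-lowprec`): certified error envelopes and
provably optimal rounding/accumulation schemes for low-precision formats under stated cost models;
every table by two implementations; no hardware or vendor claims.

The GEMM note's Lemma Z ("exact range", gemm.tex Lemma `l:Z`): if all products of two low-precision
formats lie on a grid `2^γ ℤ` with `γ ≥ qexp_A` and have modulus `≤ μ`, and `n·μ ≤ 2^(p_A + γ)`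
(and the range suffices), then EVERY evaluation order with EVERY rounding that fixes the values of
the accumulator format `A` returns the exact inner product: `ŝ = s`, `W(n) = 0`. This file is that
lemma as a Lean theorem over the venture's formats:
* `MiniFloat.eval_eq_exact_of_grid`: for any `SumTree` whose leaves are `kᵢ·2^g·quantum_α` with
  `|kᵢ| ≤ K`, `#leaves·K ≤ 2^(m_α+1)` and `#leaves·K·2^g ≤ maxScaled_α`, and any map `r` with
  `r v = v` on values of `α`: `eval r t = exact t` (induction: every node's exact argument is a
  sub-sum on the grid with at most `p_α` significant bits, hence a value, hence fixed by `r`);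
* `MiniFloat.eval_eq_exact_of_products`: leaves = products `aᵢ·bᵢ` of data of `φ₁`, `φ₂`
  (`K = maxScaled₁·maxScaled₂`, `2^g = quantum₁·quantum₂/quantum_α`);
* instances = the note's thresholds, for round-to-nearest-even AND truncation (both fix `F_α`):
  `E2M1 × E2M1 → binary16`, `n ≤ 14`; `→ binary32`, `n ≤ 116508`; `E3M2 × E3M2 → binary32`,
  `n ≤ 83`; `E2M3 × E2M3 → binary32`, `n ≤ 4660`; `E2M1 × E2M3 → binary16`, `n ≤ 2`
  (numeral checks `n·K ≤ 2^p` by `decide`).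
Beyond the threshold nothing is claimed here (the note's DP certificates show e.g. that
`E2M1² → binary16` stays exact at `n = 15`; the first nonzero `W(n)` rows are exhaustive tables).
-/

namespace Literature.ComputerArithmetic.FloatingPoint

namespace MiniFloat

open Literature.ComputerArithmetic.JeannerodRump2018

variable {φ₁ φ₂ α : Format}

/-- A grid point `k·2^g·quantum` with `|k|·2^g ≤ min(2^(p+g), maxScaled)` is a value of `α`.
[folklore] -/
theorem exists_toRat_eq_grid {k : ℤ} {g : ℕ} (hk : k.natAbs ≤ 2 ^ (α.manBits + 1))
    (hmax : k.natAbs * 2 ^ g ≤ α.maxScaled) :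
    ∃ y : MiniFloat α, y.toRat = (k : ℚ) * 2 ^ g * α.quantum := by
  have hrep : α.Representable (k.natAbs * 2 ^ g) :=
    representable_of_pow_dvd (dvd_mul_left _ _)
      (by rw [pow_add]; exact Nat.mul_le_mul_right _ hk) hmax
  have hrep' : α.Representable (k * 2 ^ g : ℤ).natAbs := by
    rw [Int.natAbs_mul, Int.natAbs_pow]; exact hrep
  obtain ⟨y, hy⟩ := exists_toRat_eq_intCast_mul _ hrep'
  exact ⟨y, by rw [hy]; push_cast; ring⟩

/-- LEMMA Z, GRID FORM: leaves on the grid `2^g·quantum_α` with coefficients `|kᵢ| ≤ K`,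
`#leaves·K ≤ 2^(p_α)` and `#leaves·K·2^g ≤ maxScaled_α`, rounding map `r` fixing the values of `α`:
the tree evaluates EXACTLY, and its exact sum is again on the grid with coefficient
`≤ #leaves·K`. [folklore] -/
theorem eval_eq_exact_of_grid (r : ℚ → ℚ) (hr : ∀ y : MiniFloat α, r y.toRat = y.toRat)
    (g K : ℕ) : ∀ t : SumTree,
      (∀ x ∈ t.leaves, ∃ k : ℤ, k.natAbs ≤ K ∧ x = (k : ℚ) * 2 ^ g * α.quantum) →
      t.leaves.length * K ≤ 2 ^ (α.manBits + 1) →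
      t.leaves.length * K * 2 ^ g ≤ α.maxScaled →
      SumTree.eval r t = SumTree.exact t ∧
        ∃ k : ℤ, k.natAbs ≤ t.leaves.length * K ∧ SumTree.exact t = (k : ℚ) * 2 ^ g * α.quantum
  | .leaf x, hx, _, _ => by
      obtain ⟨k, hk, hx'⟩ := hx x (by simp [SumTree.leaves])
      exact ⟨rfl, k, by simpa [SumTree.leaves] using hk, hx'⟩
  | .node l rt, hx, hK, hR => by
      have hlen : (SumTree.node l rt).leaves.length = l.leaves.length + rt.leaves.length := by
        simp [SumTree.leaves]
      rw [hlen] at hK hR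
      have hxl : ∀ x ∈ l.leaves, ∃ k : ℤ, k.natAbs ≤ K ∧ x = (k : ℚ) * 2 ^ g * α.quantum :=
        fun x hx' => hx x (by simp [SumTree.leaves, hx'])
      have hxr : ∀ x ∈ rt.leaves, ∃ k : ℤ, k.natAbs ≤ K ∧ x = (k : ℚ) * 2 ^ g * α.quantum :=
        fun x hx' => hx x (by simp [SumTree.leaves, hx'])
      obtain ⟨hel, kl, hkl, hxl'⟩ := eval_eq_exact_of_grid r hr g K l hxl
        (le_trans (Nat.mul_le_mul_right _ (Nat.le_add_right _ _)) hK)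
        (le_trans (Nat.mul_le_mul_right _ (Nat.mul_le_mul_right _ (Nat.le_add_right _ _))) hR)
      obtain ⟨her, kr, hkr, hxr'⟩ := eval_eq_exact_of_grid r hr g K rt hxr
        (le_trans (Nat.mul_le_mul_right _ (Nat.le_add_left _ _)) hK)
        (le_trans (Nat.mul_le_mul_right _ (Nat.mul_le_mul_right _ (Nat.le_add_left _ _))) hR)
      have hk : (kl + kr).natAbs ≤ (l.leaves.length + rt.leaves.length) * K := by
        have := Int.natAbs_add_le kl kr
        rw [Nat.add_mul]; omega
      have hsum : SumTree.exact (.node l rt) = ((kl + kr : ℤ) : ℚ) * 2 ^ g * α.quantum := by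
        simp only [SumTree.exact]; rw [hxl', hxr']; push_cast; ring
      refine ⟨?_, kl + kr, by rw [hlen]; exact hk, hsum⟩
      simp only [SumTree.eval]
      rw [hel, her]
      obtain ⟨y, hy⟩ := exists_toRat_eq_grid (α := α) (le_trans hk hK)
        (le_trans (Nat.mul_le_mul_right _ hk) hR)
      have : SumTree.exact l + SumTree.exact rt = y.toRat := by
        rw [hy, hxl', hxr']; push_cast; ring
      rw [this, hr y, ← this]; rfl

/-- LEMMA Z FOR INNER PRODUCTS: leaves are products `aᵢ·bᵢ` of data of `φ₁`, `φ₂`;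
`quantum₁·quantum₂ = 2^g·quantum_α`; `n·max₁·max₂ ≤ 2^(p_α)` and `n·max₁·max₂·2^g ≤ maxScaled_α`
(magnitudes in quanta), `r` any rounding fixing `F_α`: every evaluation order returns the exact
inner product. [folklore] -/
theorem eval_eq_exact_of_products (r : ℚ → ℚ) (hr : ∀ y : MiniFloat α, r y.toRat = y.toRat)
    {g : ℕ} (hq : φ₁.qexp + φ₂.qexp = α.qexp + g) (t : SumTree)
    (ht : ∀ x ∈ t.leaves, ∃ (a : MiniFloat φ₁) (b : MiniFloat φ₂), x = a.toRat * b.toRat)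
    (hn : t.leaves.length * (φ₁.maxScaled * φ₂.maxScaled) ≤ 2 ^ (α.manBits + 1))
    (hR : t.leaves.length * (φ₁.maxScaled * φ₂.maxScaled) * 2 ^ g ≤ α.maxScaled) :
    SumTree.eval r t = SumTree.exact t := by
  refine (eval_eq_exact_of_grid r hr g (φ₁.maxScaled * φ₂.maxScaled) t ?_ hn hR).1
  intro x hx
  obtain ⟨a, b, rfl⟩ := ht x hx
  refine ⟨a.toInt * b.toInt, ?_, ?_⟩
  · rw [Int.natAbs_mul, natAbs_toInt, natAbs_toInt]
    exact Nat.mul_le_mul a.scaledMag_le_maxScaled b.scaledMag_le_maxScaled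
  · rw [toRat_mul_toRat, hq, zpow_add₀ (by norm_num : (2:ℚ) ≠ 0), zpow_natCast]
    unfold Format.quantum; ring

/-- Round-to-nearest-even fixes the values of `α`. [folklore] -/
theorem flα_toRat (y : MiniFloat α) : flα α y.toRat = y.toRat := toRat_roundNE_toRat y

/-- Truncation fixes the values of `α`. [folklore] -/
theorem rz_toRat (y : MiniFloat α) :
    (fun z => (roundTowardZero α z).toRat) y.toRat = y.toRat := toRat_roundTowardZero_toRat y

/-! ### The note's instances -/

/-- `E2M1 × E2M1 → binary16`: every inner product of length `≤ 14` is computed EXACTLY in any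
order, under round-to-nearest-even and under truncation. [folklore] -/
theorem E2M1_dot_Binary16_exact (t : SumTree)
    (ht : ∀ x ∈ t.leaves, ∃ (a b : MiniFloat Format.E2M1), x = a.toRat * b.toRat)
    (hn : t.leaves.length ≤ 14) :
    SumTree.eval (flα Format.Binary16) t = SumTree.exact t ∧
    SumTree.eval (fun z => (roundTowardZero Format.Binary16 z).toRat) t = SumTree.exact t := by
  have h1 : t.leaves.length * (Format.E2M1.maxScaled * Format.E2M1.maxScaled)
      ≤ 2 ^ (Format.Binary16.manBits + 1) :=
    le_trans (Nat.mul_le_mul_right _ hn) (by decide)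
  have h2 : t.leaves.length * (Format.E2M1.maxScaled * Format.E2M1.maxScaled) * 2 ^ 22
      ≤ Format.Binary16.maxScaled :=
    le_trans (Nat.mul_le_mul_right _ (Nat.mul_le_mul_right _ hn)) (by decide +kernel)
  exact ⟨eval_eq_exact_of_products _ flα_toRat (g := 22) (by decide) t ht h1 h2,
    eval_eq_exact_of_products _ rz_toRat (g := 22) (by decide) t ht h1 h2⟩

/-- `E2M1 × E2M1 → binary32`: exact for every order and length `≤ 116508`. [folklore] -/
theorem E2M1_dot_Binary32_exact (t : SumTree)
    (ht : ∀ x ∈ t.leaves, ∃ (a b : MiniFloat Format.E2M1), x = a.toRat * b.toRat)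
    (hn : t.leaves.length ≤ 116508) :
    SumTree.eval (flα Format.Binary32) t = SumTree.exact t ∧
    SumTree.eval (fun z => (roundTowardZero Format.Binary32 z).toRat) t = SumTree.exact t := by
  have h1 : t.leaves.length * (Format.E2M1.maxScaled * Format.E2M1.maxScaled)
      ≤ 2 ^ (Format.Binary32.manBits + 1) :=
    le_trans (Nat.mul_le_mul_right _ hn) (by decide +kernel)
  have h2 : t.leaves.length * (Format.E2M1.maxScaled * Format.E2M1.maxScaled) * 2 ^ 147
      ≤ Format.Binary32.maxScaled :=
    le_trans (Nat.mul_le_mul_right _ (Nat.mul_le_mul_right _ hn)) (by decide +kernel)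
  exact ⟨eval_eq_exact_of_products _ flα_toRat (g := 147) (by decide) t ht h1 h2,
    eval_eq_exact_of_products _ rz_toRat (g := 147) (by decide) t ht h1 h2⟩

/-- `E3M2 × E3M2 → binary32`: exact for every order and length `≤ 83`. [folklore] -/
theorem E3M2_dot_Binary32_exact (t : SumTree)
    (ht : ∀ x ∈ t.leaves, ∃ (a b : MiniFloat Format.E3M2), x = a.toRat * b.toRat)
    (hn : t.leaves.length ≤ 83) :
    SumTree.eval (flα Format.Binary32) t = SumTree.exact t ∧
    SumTree.eval (fun z => (roundTowardZero Format.Binary32 z).toRat) t = SumTree.exact t := by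
  have h1 : t.leaves.length * (Format.E3M2.maxScaled * Format.E3M2.maxScaled)
      ≤ 2 ^ (Format.Binary32.manBits + 1) :=
    le_trans (Nat.mul_le_mul_right _ hn) (by decide +kernel)
  have h2 : t.leaves.length * (Format.E3M2.maxScaled * Format.E3M2.maxScaled) * 2 ^ 141
      ≤ Format.Binary32.maxScaled :=
    le_trans (Nat.mul_le_mul_right _ (Nat.mul_le_mul_right _ hn)) (by decide +kernel)
  exact ⟨eval_eq_exact_of_products _ flα_toRat (g := 141) (by decide) t ht h1 h2,
    eval_eq_exact_of_products _ rz_toRat (g := 141) (by decide) t ht h1 h2⟩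

/-- `E2M3 × E2M3 → binary32`: exact for every order and length `≤ 4660`. [folklore] -/
theorem E2M3_dot_Binary32_exact (t : SumTree)
    (ht : ∀ x ∈ t.leaves, ∃ (a b : MiniFloat Format.E2M3), x = a.toRat * b.toRat)
    (hn : t.leaves.length ≤ 4660) :
    SumTree.eval (flα Format.Binary32) t = SumTree.exact t ∧
    SumTree.eval (fun z => (roundTowardZero Format.Binary32 z).toRat) t = SumTree.exact t := by
  have h1 : t.leaves.length * (Format.E2M3.maxScaled * Format.E2M3.maxScaled)
      ≤ 2 ^ (Format.Binary32.manBits + 1) :=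
    le_trans (Nat.mul_le_mul_right _ hn) (by decide +kernel)
  have h2 : t.leaves.length * (Format.E2M3.maxScaled * Format.E2M3.maxScaled) * 2 ^ 143
      ≤ Format.Binary32.maxScaled :=
    le_trans (Nat.mul_le_mul_right _ (Nat.mul_le_mul_right _ hn)) (by decide +kernel)
  exact ⟨eval_eq_exact_of_products _ flα_toRat (g := 143) (by decide) t ht h1 h2,
    eval_eq_exact_of_products _ rz_toRat (g := 143) (by decide) t ht h1 h2⟩

/-- `E2M1 × E2M3 → binary16`: exact for every order and length `≤ 2`. [folklore] -/
theorem E2M1_E2M3_dot_Binary16_exact (t : SumTree)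
    (ht : ∀ x ∈ t.leaves, ∃ (a : MiniFloat Format.E2M1) (b : MiniFloat Format.E2M3),
      x = a.toRat * b.toRat)
    (hn : t.leaves.length ≤ 2) :
    SumTree.eval (flα Format.Binary16) t = SumTree.exact t ∧
    SumTree.eval (fun z => (roundTowardZero Format.Binary16 z).toRat) t = SumTree.exact t := by
  have h1 : t.leaves.length * (Format.E2M1.maxScaled * Format.E2M3.maxScaled)
      ≤ 2 ^ (Format.Binary16.manBits + 1) :=
    le_trans (Nat.mul_le_mul_right _ hn) (by decide)
  have h2 : t.leaves.length * (Format.E2M1.maxScaled * Format.E2M3.maxScaled) * 2 ^ 20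
      ≤ Format.Binary16.maxScaled :=
    le_trans (Nat.mul_le_mul_right _ (Nat.mul_le_mul_right _ hn)) (by decide +kernel)
  exact ⟨eval_eq_exact_of_products _ flα_toRat (g := 20) (by decide) t ht h1 h2,
    eval_eq_exact_of_products _ rz_toRat (g := 20) (by decide) t ht h1 h2⟩

/-- The thresholds are the note's: `14·144 ≤ 2^11 < 15·144`, `116508·144 ≤ 2^24 < 116509·144`,
`83·448² ≤ 2^24 < 84·448²`, `4660·60² ≤ 2^24 < 4661·60²`, `2·720 ≤ 2^11 < 3·720` (magnitudes
`maxScaled`: `E2M1 = 12`, `E3M2 = 448`, `E2M3 = 60` quanta). [folklore] -/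
theorem lemmaZ_thresholds :
    Format.E2M1.maxScaled = 12 ∧ Format.E3M2.maxScaled = 448 ∧ Format.E2M3.maxScaled = 60 ∧
    (14 * 144 ≤ 2 ^ 11 ∧ 2 ^ 11 < 15 * 144) ∧ (116508 * 144 ≤ 2 ^ 24 ∧ 2 ^ 24 < 116509 * 144) ∧
    (83 * 448 ^ 2 ≤ 2 ^ 24 ∧ 2 ^ 24 < 84 * 448 ^ 2) ∧ (4660 * 60 ^ 2 ≤ 2 ^ 24 ∧ 2 ^ 24 < 4661 * 60 ^ 2)
    ∧ (2 * 720 ≤ 2 ^ 11 ∧ 2 ^ 11 < 3 * 720) := by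
  decide +kernel

end MiniFloat

end Literature.ComputerArithmetic.FloatingPoint
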